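import Literature.Analysis.FluidPDE.NSLerayHopfSereginProfile
import Literature.Analysis.FluidPDE.SuitableWeakRescaling
import Literature.Analysis.FluidPDE.LerayFarFieldRegularity
import HarnessLib

/-!
# Local Leray solutions under the viscosity scaling; `leray_solution_exists_ae_eq_kato` from E and W

Analysis/FluidPDE proof file (no new definitions, no new named facts). The local Leray theory of
Lemarié-Rieusset 2016, Ch. 14–15 is printed for every viscosity `ν > 0`, whereas the tree's
named facts **E** `leray_solution_exists_of_memLp_three` (existence of Leray solutions for `L³`
data) and **W** `leray_solution_ae_eq_kato` (weak–strong uniqueness, Rusin–Šverák 2011 Thm. 4.1 /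
Jia–Šverák 2013 Lemma 3 / Lemarié-Rieusset 2016 Thm. 15.1 (B)) of `RusinSverakLeraySolutions.lean`
are stated with `ν = 1`, as in the papers. The link is the elementary scaling
`v(t, x) = α V(α t, x)`, `p(t, x) = α² P₁(α t, x)`, which maps solutions of the Navier–Stokes
equations with viscosity `μ` to solutions with viscosity `α μ` (Rusin–Šverák 2011, §1; Tao 2013,
footnote 3; the mild-solution side is `KatoViscosityScaling.lean`). This file **proves**

* `IsLocalLeraySolution.viscosityRescale` — the class of local Leray solutions
  (`IsLocalLeraySolution`, Jia–Šverák's `𝒩(u₀)` = Kang–Miura–Tsai Def. 3.2) is mapped by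
  `(V, P₁) ↦ (α V(α ·, ·), α² P₁(α ·, ·))` from viscosity `μ`, datum `U₀` to viscosity `α μ`,
  datum `α U₀` (`α > 0`): every clause is transported along the time dilation
  `Φ(s, y) = (α s, y)` (the accepted `IsSuitableWeakSolutionOn.stRescale`,
  `HasWeakSpatialGradientOn.stRescale` with `γ = 1`, and the changes of variables of
  `SpaceTimeRescaling.lean`);
* `leray_solution_exists_ae_eq_kato_of_leray_theory :
    leray_solution_exists_of_memLp_three → leray_solution_ae_eq_kato →
    leray_solution_exists_ae_eq_kato` — the general-`ν` named fact of
  `NSLerayHopfSereginProfile.lean` (a Kato solution with `L³` datum agrees a.e. with a local Leray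
  solution; Lemarié-Rieusset 2016, Prop. 15.1 + Thm. 14.7) from **E** and **W**: normalise the
  Kato solution to unit viscosity (`ũ(s, x) = ν⁻¹ u(ν⁻¹ s, x)`, `IsKatoSolutionOn.toUnitViscosity`
  of `LerayFarFieldRegularity.lean`), take
  a Leray solution `(V, P₁) ∈ 𝒩₁(ν⁻¹ u₀)` agreeing with `ũ`, and scale back with `α = ν`.

After this file the trust base of `seregin_blowup_profile_of_facts` contains **E**, **W** in
place of `leray_solution_exists_ae_eq_kato`.

## References

* W. Rusin, V. Šverák, J. Funct. Anal. 260 (2011) = arXiv:0911.0500, §1 (unit viscosity).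
* T. Tao, Anal. PDE 6 (2013) = arXiv:1108.1165, footnote 3 (viscosity rescaling).
* P. G. Lemarié-Rieusset, *The Navier–Stokes Problem in the 21st Century* (2016), Prop. 15.1,
  Thm. 14.7, Thm. 15.1 (A)–(B) (the theory for every `ν > 0`).
* H. Jia, V. Šverák, SIAM J. Math. Anal. 45 (2013) = arXiv:1201.1592, Def. 1, §3 p. 6.
-/

noncomputable section

open MeasureTheory TopologicalSpace Set Function Filter Metric
open _root_.Topology
open scoped ENNReal NNReal RealInnerProductSpace

namespace Literature.Analysis.FluidPDE

/-! ### The time dilation `Φ(s, y) = (α s, y)` -/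

/-- The time dilation pulls the open slab `(0, ∞) × ℝ³` back to itself (`α > 0`). [folklore] -/
theorem stPreimage_slab_Ioi {α : ℝ} (hα : 0 < α) :
    stPreimage α 1 0 (0 : (EuclideanSpace ℝ (Fin 3))) (slab (EuclideanSpace ℝ (Fin 3)) (Ioi 0) isOpen_Ioi) = slab (EuclideanSpace ℝ (Fin 3)) (Ioi 0) isOpen_Ioi := by
  ext z
  simp only [coe_stPreimage, mem_preimage, SetLike.mem_coe, mem_slab, stAffine_fst, zero_add,
    mem_Ioi]
  exact mul_pos_iff_of_pos_left hα

/-- A larger radius absorbing the time dilation: `R' = R (1 + α)` has `R ≤ R'` and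
`α R² ≤ R'²`. [folklore] -/
theorem radius_absorb {α R : ℝ} (hα : 0 < α) (hR : 0 < R) :
    R ≤ R * (1 + α) ∧ α * R ^ 2 ≤ (R * (1 + α)) ^ 2 ∧ 0 < R * (1 + α) := by
  refine ⟨?_, ?_, by positivity⟩
  · nlinarith
  · nlinarith [sq_nonneg R, sq_nonneg (R * α), mul_pos hα hR]

/-- The small cylinder `(0, R²) × B(x₀, R)` lies in the pull-back of the large one
`(0, R'²) × B(x₀, R')`, `R' = R(1 + α)`, under the time dilation. [folklore] -/
theorem Ioo_prod_ball_subset_preimage {α R : ℝ} (hα : 0 < α) (hR : 0 < R) (x₀ : (EuclideanSpace ℝ (Fin 3))) :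
    Ioo 0 (R ^ 2) ×ˢ ball x₀ R ⊆
      stAffine α 1 0 (0 : (EuclideanSpace ℝ (Fin 3))) ⁻¹' (Ioo 0 ((R * (1 + α)) ^ 2) ×ˢ ball x₀ (R * (1 + α))) := by
  obtain ⟨h1, h2, -⟩ := radius_absorb hα hR
  rintro ⟨s, y⟩ ⟨⟨hs0, hs1⟩, hy⟩
  simp only [mem_preimage, stAffine_apply, zero_add, one_smul, mem_prod, mem_Ioo]
  refine ⟨⟨mul_pos hα hs0, ?_⟩, ball_subset_ball h1 hy⟩
  calc α * s < α * R ^ 2 := mul_lt_mul_of_pos_left hs1 hα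
    _ ≤ (R * (1 + α)) ^ 2 := h2

/-! ### Local Leray solutions under the viscosity scaling -/

/-- **Covariance of local Leray solutions under the viscosity scaling** (Rusin–Šverák 2011, §1;
Tao 2013, footnote 3; the class of Lemarié-Rieusset 2016 Def. 14.1 / Jia–Šverák Def. 1 /
Kang–Miura–Tsai Def. 3.2 is written for any viscosity). If `(V, P₁)` is a local Leray solution
with viscosity `μ` and datum `U₀` (`IsLocalLeraySolution μ U₀ V P₁`), then for `α > 0` the pair
`v(t, x) = α V(α t, x)`, `p(t, x) = α² P₁(α t, x)` is a local Leray solution with viscosity `α μ`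
and datum `α U₀`: the suitable weak formulation is covariant (`IsSuitableWeakSolutionOn.stRescale`
with space dilation `γ = 1`), as is the weak spatial gradient `α ∇V(α ·, ·)`; the local and
uniformly local `L²`/`L^{3/2}` bounds, the attainment of the datum in `L²_loc` and the decay at
spatial infinity are transported by the change of variables `t = α s` (a cylinder of radius `R`
in the new time is contained in the pull-back of a cylinder of radius `R(1 + α)`).
[cite: RusinSverak2011, §1 (arXiv:0911.0500 p. 3, unit viscosity)] -/
theorem IsLocalLeraySolution.viscosityRescale {μ : ℝ} {U₀ : (EuclideanSpace ℝ (Fin 3)) → (EuclideanSpace ℝ (Fin 3))} {V : ℝ → (EuclideanSpace ℝ (Fin 3)) → (EuclideanSpace ℝ (Fin 3))}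
    {P₁ : ℝ → (EuclideanSpace ℝ (Fin 3)) → ℝ} (h : IsLocalLeraySolution μ U₀ V P₁) {α : ℝ} (hα : 0 < α) :
    IsLocalLeraySolution (α * μ) (α • U₀) (α • stPull α 1 0 (0 : (EuclideanSpace ℝ (Fin 3))) V)
      (α ^ 2 • stPull α 1 0 (0 : (EuclideanSpace ℝ (Fin 3))) P₁) := by
  have hβ : α = α * 1 := (mul_one α).symm
  have hn : Module.finrank ℝ (EuclideanSpace ℝ (Fin 3)) = 3 := finrank_euclideanSpace_fin
  -- the Jacobian constant of `Φ(s, y) = (α s, y)`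
  have hJ : ENNReal.ofReal (α * (1 : ℝ) ^ Module.finrank ℝ (EuclideanSpace ℝ (Fin 3)))⁻¹ = ENNReal.ofReal α⁻¹ := by
    rw [one_pow, mul_one]
  -- pointwise form of the rescaled velocity
  have hv : ∀ t x, (α • stPull α 1 0 (0 : (EuclideanSpace ℝ (Fin 3))) V) t x = α • V (α * t) x := fun t x => by
    rw [smul_stPull_apply, zero_add, zero_add, one_smul]
  -- `Φ⁻¹((0, αT) × K) = (0, T) × K`
  have hpre : ∀ (T : ℝ) (K : Set (EuclideanSpace ℝ (Fin 3))),
      stAffine α 1 0 (0 : (EuclideanSpace ℝ (Fin 3))) ⁻¹' (Ioo 0 (α * T) ×ˢ K) = Ioo 0 T ×ˢ K := fun T K => by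
    have h1 := stAffine_preimage_Ioo_prod hα 0 T K
    rwa [mul_zero] at h1
  refine
    { suitable := ?_
      sqIntegrable := ?_
      pressure := ?_
      uniformLocalEnergy := ?_
      uniformLocalGradient := ?_
      initial := ?_
      decay := ?_ }
  · -- (1)+(4): suitability is covariant
    have hs := h.suitable.stRescale hα one_pos hβ 0 (0 : (EuclideanSpace ℝ (Fin 3)))
    rw [stPreimage_slab_Ioi hα, div_one] at hs
    have hf : ((α ^ 2 * (1 : ℝ)) • stPull α 1 0 (0 : (EuclideanSpace ℝ (Fin 3))) (0 : ℝ → (EuclideanSpace ℝ (Fin 3)) → (EuclideanSpace ℝ (Fin 3)))) = 0 := by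
      funext s y
      simp [stPull]
    rw [hf] at hs
    exact hs
  · -- `v ∈ L²((0, T) × K)`
    intro T hT K hK
    have h1 := setLIntegral_enorm_pow_stRescale hα one_pos 0 (0 : (EuclideanSpace ℝ (Fin 3))) α V (Ioo 0 (α * T) ×ˢ K) 2
    rw [hpre, hJ] at h1
    rw [h1]
    exact ENNReal.mul_lt_top (ENNReal.mul_lt_top (ENNReal.pow_lt_top enorm_lt_top)
      ENNReal.ofReal_lt_top) (h.sqIntegrable (α * T) (mul_pos hα hT) K hK)
  · -- `p ∈ L^{3/2}((0, T) × K)`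
    intro T hT K hK
    have h1 := setLIntegral_enorm_rpow_stRescale hα one_pos 0 (0 : (EuclideanSpace ℝ (Fin 3))) (α ^ 2) P₁
      (Ioo 0 (α * T) ×ˢ K) (r := 3 / 2) (by norm_num)
    rw [hpre, hJ] at h1
    rw [h1]
    exact ENNReal.mul_lt_top (ENNReal.mul_lt_top
      (ENNReal.rpow_lt_top_of_nonneg (by norm_num) enorm_ne_top) ENNReal.ofReal_lt_top)
      (h.pressure (α * T) (mul_pos hα hT) K hK)
  · -- (2), first half: uniformly local energy
    intro R hR
    obtain ⟨hRR', hαR, hR'⟩ := radius_absorb hα hR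
    set R' : ℝ := R * (1 + α) with hR'_def
    obtain ⟨C, hC⟩ := h.uniformLocalEnergy R' hR'
    -- transport the a.e.-in-time bound along `t ↦ α t` to `(0, R'²/α) ⊇ (0, R²)`
    have hC' : ∀ᵐ t ∂(volume.restrict (Ioo (0 + α * 0) (0 + α * (R' ^ 2 / α)))),
        ∀ x₀ : (EuclideanSpace ℝ (Fin 3)), ∫⁻ x in ball x₀ R', ‖V t x‖ₑ ^ 2 ≤ C := by
      have e : Ioo (0 + α * 0) (0 + α * (R' ^ 2 / α)) = Ioo 0 (R' ^ 2) := by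
        rw [mul_zero, add_zero, zero_add, mul_div_cancel₀ _ hα.ne']
      rw [e]
      exact hC
    have h2 := ae_restrict_Ioo_comp_time_affine hα 0 0 (R' ^ 2 / α) hC'
    have hsub : Ioo (0 : ℝ) (R ^ 2) ⊆ Ioo 0 (R' ^ 2 / α) := by
      refine Ioo_subset_Ioo le_rfl ?_
      rw [le_div_iff₀ hα, mul_comm]
      exact hαR
    have h3 := ae_restrict_of_ae_restrict_of_subset hsub h2
    set C₁ : ℝ≥0∞ := ‖α‖ₑ ^ 2 * C with hC₁
    have hC₁top : C₁ ≠ ∞ := ENNReal.mul_ne_top (ENNReal.pow_ne_top enorm_ne_top) ENNReal.coe_ne_top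
    refine ⟨C₁.toNNReal, ?_⟩
    rw [ENNReal.coe_toNNReal hC₁top]
    filter_upwards [h3] with t ht x₀
    have e1 : ∀ x, ‖(α • stPull α 1 0 (0 : (EuclideanSpace ℝ (Fin 3))) V) t x‖ₑ ^ 2 = ‖α‖ₑ ^ 2 * ‖V (α * t) x‖ₑ ^ 2 :=
      fun x => by rw [hv, enorm_smul, mul_pow]
    simp_rw [e1]
    rw [lintegral_const_mul' _ _ (ENNReal.pow_ne_top enorm_ne_top)]
    refine mul_le_mul' le_rfl ((lintegral_mono_set (ball_subset_ball hRR')).trans ?_)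
    simpa only [zero_add] using ht x₀
  · -- (2), second half: the weak spatial gradient `α ∇V(α ·, ·)`
    obtain ⟨G, hG, hGb⟩ := h.uniformLocalGradient
    refine ⟨(α * 1) • stPull α 1 0 (0 : (EuclideanSpace ℝ (Fin 3))) G, ?_, ?_⟩
    · have h1 := hG.stRescale α hα one_pos 0 (0 : (EuclideanSpace ℝ (Fin 3)))
      rw [stPreimage_slab_Ioi hα] at h1
      exact h1
    · intro R hR
      obtain ⟨hRR', hαR, hR'⟩ := radius_absorb hα hR
      set R' : ℝ := R * (1 + α) with hR'_def
      obtain ⟨C, hC⟩ := hGb R' hR'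
      set C₁ : ℝ≥0∞ := ENNReal.ofReal ((α * 1) ^ 2) * ENNReal.ofReal α⁻¹ * C with hC₁
      have hC₁top : C₁ ≠ ∞ :=
        ENNReal.mul_ne_top (ENNReal.mul_ne_top ENNReal.ofReal_ne_top ENNReal.ofReal_ne_top)
          ENNReal.coe_ne_top
      refine ⟨C₁.toNNReal, fun x₀ => ?_⟩
      rw [ENNReal.coe_toNNReal hC₁top]
      have h1 := setLIntegral_frobeniusNormSq_stRescale hα one_pos 0 (0 : (EuclideanSpace ℝ (Fin 3))) (α * 1) G
        (Ioo 0 (R' ^ 2) ×ˢ ball x₀ R')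
      rw [hJ] at h1
      calc ∫⁻ z in Ioo 0 (R ^ 2) ×ˢ ball x₀ R,
            ENNReal.ofReal (frobeniusNormSq (((α * 1) • stPull α 1 0 (0 : (EuclideanSpace ℝ (Fin 3))) G) z.1 z.2))
          ≤ ∫⁻ z in stAffine α 1 0 (0 : (EuclideanSpace ℝ (Fin 3))) ⁻¹' (Ioo 0 (R' ^ 2) ×ˢ ball x₀ R'),
              ENNReal.ofReal (frobeniusNormSq (((α * 1) • stPull α 1 0 (0 : (EuclideanSpace ℝ (Fin 3))) G) z.1 z.2)) :=
            lintegral_mono_set (Ioo_prod_ball_subset_preimage hα hR x₀)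
        _ = ENNReal.ofReal ((α * 1) ^ 2) * ENNReal.ofReal α⁻¹ *
              ∫⁻ z in Ioo 0 (R' ^ 2) ×ˢ ball x₀ R', ENNReal.ofReal (frobeniusNormSq (G z.1 z.2)) :=
            h1
        _ ≤ C₁ := mul_le_mul' le_rfl (hC x₀)
  · -- (3): the datum `α U₀` is attained in `L²_loc`
    intro K hK
    have e1 : ∀ t, ∫⁻ x in K, ‖(α • stPull α 1 0 (0 : (EuclideanSpace ℝ (Fin 3))) V) t x - (α • U₀) x‖ₑ ^ 2 =
        ‖α‖ₑ ^ 2 * ∫⁻ x in K, ‖V (α * t) x - U₀ x‖ₑ ^ 2 := by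
      intro t
      have e2 : ∀ x, ‖(α • stPull α 1 0 (0 : (EuclideanSpace ℝ (Fin 3))) V) t x - (α • U₀) x‖ₑ ^ 2 =
          ‖α‖ₑ ^ 2 * ‖V (α * t) x - U₀ x‖ₑ ^ 2 := fun x => by
        rw [hv, Pi.smul_apply, ← smul_sub, enorm_smul, mul_pow]
      simp_rw [e2]
      rw [lintegral_const_mul' _ _ (ENNReal.pow_ne_top enorm_ne_top)]
    simp_rw [e1]
    have hmap : Tendsto (fun t : ℝ => α * t) (𝓝[>] (0 : ℝ)) (𝓝[>] (0 : ℝ)) := by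
      have h1 : Tendsto (fun t : ℝ => α * t) (𝓝 0) (𝓝 (α * 0)) :=
        (continuous_const_mul α).tendsto 0
      rw [mul_zero] at h1
      refine tendsto_nhdsWithin_of_tendsto_nhds_of_eventually_within _
        (h1.mono_left nhdsWithin_le_nhds) ?_
      filter_upwards [self_mem_nhdsWithin] with t ht
      exact mul_pos hα ht
    have h2 := (h.initial K hK).comp hmap
    have h3 := ENNReal.Tendsto.const_mul h2 (Or.inr (ENNReal.pow_ne_top enorm_ne_top) :
      (0 : ℝ≥0∞) ≠ 0 ∨ ‖α‖ₑ ^ 2 ≠ ∞)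
    rw [mul_zero] at h3
    exact h3
  · -- (7): decay at spatial infinity
    intro R hR
    obtain ⟨hRR', hαR, hR'⟩ := radius_absorb hα hR
    set R' : ℝ := R * (1 + α) with hR'_def
    have hbound : ∀ x₀ : (EuclideanSpace ℝ (Fin 3)),
        ∫⁻ z in Ioo 0 (R ^ 2) ×ˢ ball x₀ R, ‖(α • stPull α 1 0 (0 : (EuclideanSpace ℝ (Fin 3))) V) z.1 z.2‖ₑ ^ 2 ≤
          ‖α‖ₑ ^ 2 * ENNReal.ofReal α⁻¹ *
            ∫⁻ z in Ioo 0 (R' ^ 2) ×ˢ ball x₀ R', ‖V z.1 z.2‖ₑ ^ 2 := by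
      intro x₀
      have h1 := setLIntegral_enorm_pow_stRescale hα one_pos 0 (0 : (EuclideanSpace ℝ (Fin 3))) α V
        (Ioo 0 (R' ^ 2) ×ˢ ball x₀ R') 2
      rw [hJ] at h1
      rw [← h1]
      exact lintegral_mono_set (Ioo_prod_ball_subset_preimage hα hR x₀)
    have h2 := ENNReal.Tendsto.const_mul (h.decay R' hR')
      (Or.inr (ENNReal.mul_ne_top (ENNReal.pow_ne_top enorm_ne_top) ENNReal.ofReal_ne_top) :
        (0 : ℝ≥0∞) ≠ 0 ∨ ‖α‖ₑ ^ 2 * ENNReal.ofReal α⁻¹ ≠ ∞)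
    rw [mul_zero] at h2
    exact tendsto_of_tendsto_of_tendsto_of_le_of_le tendsto_const_nhds h2 (fun _ => zero_le)
      hbound

/-! ### `leray_solution_exists_ae_eq_kato` from E and W -/

/-- **`leray_solution_exists_ae_eq_kato` from E and W** (existence of Leray solutions for `L³`
data and weak–strong uniqueness at `ν = 1`, `RusinSverakLeraySolutions.lean`; Rusin–Šverák 2011
§4 and Thm. 4.1, Jia–Šverák 2013 §§2–3 with Lemma 3, Lemarié-Rieusset 2016 Prop. 15.1 and
Thm. 15.1 (B)). Given a Kato solution `u` on `[0, T)` with viscosity `ν` and weakly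
divergence-free datum `u₀ ∈ L³`: the normalised `ũ(s, x) = ν⁻¹ u(ν⁻¹ s, x)` is a Kato solution on
`[0, ν T)` with viscosity `1` and datum `ν⁻¹ u₀` (`IsKatoSolutionOn.toUnitViscosity`, `LerayFarFieldRegularity.lean`); by E
there is `(V, P₁) ∈ 𝒩₁(ν⁻¹ u₀)`, by W `V = ũ` a.e. on `(0, ν T) × ℝ³`; scaling back,
`v(t, x) = ν V(ν t, x)`, `p = ν² P₁(ν t, x)` is a local Leray solution with viscosity `ν` and
datum `u₀` (`IsLocalLeraySolution.viscosityRescale`) and `v = u` a.e. on `(0, T) × ℝ³` (a.e.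
equality transported along the time dilation). [cite: LemarieRieusset2016, Thm. 15.1 (A)–(B) p. 565 with Prop. 15.1] [cite: JiaSverak2013, §3 p. 6 with Lemma 3] -/
theorem leray_solution_exists_ae_eq_kato_of_leray_theory
    (hE : leray_solution_exists_of_memLp_three) (hW : leray_solution_ae_eq_kato) :
    leray_solution_exists_ae_eq_kato := by
  intro ν T hν hT u₀ u hu₀ hdiv hu
  -- normalise to unit viscosity
  have hũ := hu.toUnitViscosity hν
  have hũ₀ : MemLp (ν⁻¹ • u₀) 3 volume := hu₀.const_smul ν⁻¹
  have hũdiv : IsWeaklyDivFree (ν⁻¹ • u₀) := hdiv.const_smul ν⁻¹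
  -- E and W at `ν = 1`
  obtain ⟨V, P₁, hV⟩ := hE (ν⁻¹ • u₀) hũ₀ hũdiv
  have hae := hW (ν⁻¹ • u₀) hũ₀ hũdiv V P₁ hV (ν * T) (timeRescale ν⁻¹ ν⁻¹ u) hũ
  -- scale back
  have hv := hV.viscosityRescale hν
  rw [mul_one, smul_smul, mul_inv_cancel₀ hν.ne', one_smul] at hv
  refine ⟨ν • stPull ν 1 0 (0 : (EuclideanSpace ℝ (Fin 3))) V, ν ^ 2 • stPull ν 1 0 (0 : (EuclideanSpace ℝ (Fin 3))) P₁, hv, ?_⟩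
  -- `v = u` a.e. on `(0, T) × ℝ³`
  have h1 := ae_eq_restrict_comp_stAffine hν one_pos 0 (0 : (EuclideanSpace ℝ (Fin 3))) hae
  have hpre : stAffine ν 1 0 (0 : (EuclideanSpace ℝ (Fin 3))) ⁻¹' (Ioo 0 (ν * T) ×ˢ (univ : Set (EuclideanSpace ℝ (Fin 3)))) =
      Ioo 0 T ×ˢ univ := by
    have h2 := stAffine_preimage_Ioo_prod hν 0 T (univ : Set (EuclideanSpace ℝ (Fin 3)))
    rwa [mul_zero] at h2
  rw [hpre] at h1
  filter_upwards [h1] with z hz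
  simp only [comp_apply] at hz
  change (ν • stPull ν 1 0 (0 : (EuclideanSpace ℝ (Fin 3))) V) z.1 z.2 = u z.1 z.2
  rw [smul_stPull_apply, zero_add, zero_add, one_smul]
  have hz' : V (ν * z.1) z.2 = timeRescale ν⁻¹ ν⁻¹ u (ν * z.1) z.2 := by
    have := hz
    simp only [uncurry, stAffine_fst, stAffine_snd, zero_add, one_smul] at this
    exact this
  rw [hz', timeRescale_apply, smul_smul, ← mul_assoc, mul_inv_cancel₀ hν.ne',
    inv_mul_cancel₀ hν.ne', one_mul, one_smul]

end Literature.Analysis.FluidPDE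

end
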